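import Summits.Ventures.Crystal3D.StickySpheres.FccLoomisWhitney
import HarnessLib

/-!
# The fcc deficiency identity: `2C + #∂ψ₁ + #∂ψ₂ = 12N`

HONEST FRAMING. Part of the venture `Summits/Ventures/Crystal3D` (cells `pub-crystal3d`,
`crystal3d-full`). On-lattice bookkeeping for the fcc packing; nothing off-lattice.

`FccLoomisWhitney.lean` uses the two unimodular charts `ψ₁(k,i,j) = (i, j+k, −k)`,
`ψ₂(k,i,j) = (k+i+j, i+j, −j)` of the fcc contact graph only through the INEQUALITY
`2C + #∂ψ₁ + #∂ψ₂ ≤ 12N` (`∂ψ` = boundary pairs of the chart image in `ℤ³`).  Here we record the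
EQUALITY (`two_mul_numContacts_add_card_boundaryPairs_eq`): the twelve fcc contact offsets are
EXACTLY the `±` unit steps of the two charts, six each, so every slot `(site, ±e_d)` of either chart
is occupied precisely by a contact.  Consequently the contact deficiency of an fcc cluster is half
the total number of boundary pairs of its two chart images,
`6N − C = ½ (#∂ψ₁ + #∂ψ₂)` — the counting device for the truncated-octahedron construction of the
cell `crystal3d-full` (HOME/eng/MEMO-3.md «NEXT KERNEL TARGET»: for line-convex clusters the
boundary pairs are twice the shadow counts, so `D(X)` is the sum of the six `⟨110⟩` shadow counts).

WHAT THIS IS NOT: no cluster is constructed here; rung F-C1 of the cell is not moved.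
-/

noncomputable section

namespace Summit.Ventures.Crystal3D

open Finset
open Literature.Probability.LatticeModels (Site unitStep unitStep_apply boundaryPairs)
open Literature.MathematicalPhysics.StatisticalMechanics (barlowPos fccStacking constHagg
  isHaggSeq_const haggLabel_const dist_barlowPos_eq_iff_form le_dist_barlowPos_of_ideal)

set_option maxHeartbeats 400000 in
/-- **The fcc deficiency identity.** For a unit packing `x` on the fcc packing with integer
coordinates `x i = barlowPos 1 √(2/3) constHagg (kf i) (pf i) (qf i)`, the charts
`ψ₁ = (pf, qf + kf, −kf)` and `ψ₂ = (kf + pf + qf, pf + qf, −qf)` satisfy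
`2·numContacts x + #∂(ψ₁-image) + #∂(ψ₂-image) = 12N`. -/
theorem two_mul_numContacts_add_card_boundaryPairs_eq {N : ℕ}
    (x : Fin N → EuclideanSpace ℝ (Fin 3)) (hx : IsUnitPacking x) (kf pf qf : Fin N → ℤ)
    (hc : ∀ i, x i = barlowPos 1 (Real.sqrt (2 / 3)) constHagg (kf i) (pf i) (qf i)) :
    2 * numContacts x +
      (boundaryPairs (univ.image fun i => (![pf i, qf i + kf i, -kf i] : Site 3))).card +
      (boundaryPairs (univ.image fun i =>
        (![kf i + pf i + qf i, pf i + qf i, -qf i] : Site 3))).card = 12 * N := by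
  classical
  have hh : (Real.sqrt (2 / 3)) ^ 2 = 2 / 3 * (1 : ℝ) ^ 2 := by
    rw [Real.sq_sqrt (by norm_num)]; ring
  set a₁ : Fin N → Site 3 := fun i => ![pf i, qf i + kf i, -kf i] with ha₁
  set a₂ : Fin N → Site 3 := fun i => ![kf i + pf i + qf i, pf i + qf i, -qf i] with ha₂
  have hinjx := hx.injective
  have hcoord_inj : ∀ i j, kf i = kf j → pf i = pf j → qf i = qf j → i = j := by
    intro i j h1 h2 h3
    apply hinjx; rw [hc i, hc j, h1, h2, h3]
  have ha₁inj : Function.Injective a₁ := by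
    intro i j h
    have h0 := congrFun h 0; have h1 := congrFun h 1; have h2 := congrFun h 2
    simp only [ha₁, Matrix.cons_val_zero, Matrix.cons_val_one, Matrix.cons_val] at h0 h1 h2
    exact hcoord_inj i j (by omega) h0 (by omega)
  have ha₂inj : Function.Injective a₂ := by
    intro i j h
    have h0 := congrFun h 0; have h1 := congrFun h 1; have h2 := congrFun h 2
    simp only [ha₂, Matrix.cons_val_zero, Matrix.cons_val_one, Matrix.cons_val] at h0 h1 h2
    exact hcoord_inj i j (by omega) (by omega) (by omega)
  -- contact ↔ distance form of the coordinate differences (`j` minus `i`) equals twelve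
  have hform : ∀ i j, dist (x i) (x j) = 1 ↔
      3 * (2 * (pf j - pf i) + (qf j - qf i) + (kf j - kf i)) ^ 2 +
        (3 * (qf j - qf i) + (kf j - kf i)) ^ 2 + 8 * (kf j - kf i) ^ 2 = 12 := by
    intro i j
    rw [dist_comm, hc j, hc i, dist_barlowPos_eq_iff_form one_pos hh constHagg,
      haggLabel_const, haggLabel_const]
  -- (→) every contact is a unit step in one of the charts
  have hstep : ∀ i j, dist (x i) (x j) = 1 →
      (∃ d : Fin 3, ∃ b : Bool, a₁ j = a₁ i + unitStep d b) ∨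
        (∃ d : Fin 3, ∃ b : Bool, a₂ j = a₂ i + unitStep d b) := by
    intro i j hd
    rcases step_of_fccForm_eq_twelve _ _ _ ((hform i j).1 hd) with ⟨d, b, h⟩ | ⟨d, b, h⟩
    · refine Or.inl ⟨d, b, ?_⟩
      ext l; rw [Pi.add_apply, ← congrFun h l]
      fin_cases l <;> simp [ha₁] <;> ring
    · refine Or.inr ⟨d, b, ?_⟩
      ext l; rw [Pi.add_apply, ← congrFun h l]
      fin_cases l <;> simp [ha₂] <;> ring
  -- (←) every unit step of either chart is a contact, and of one chart only
  have hback₁ : ∀ i j (d : Fin 3) (b : Bool), a₁ j = a₁ i + unitStep d b →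
      dist (x i) (x j) = 1 ∧ ¬ ∃ d' : Fin 3, ∃ b' : Bool, a₂ j = a₂ i + unitStep d' b' := by
    intro i j d b h
    have h0 := congrFun h 0; have h1 := congrFun h 1; have h2 := congrFun h 2
    simp only [ha₁, Pi.add_apply, unitStep_apply, Matrix.cons_val_zero, Matrix.cons_val_one,
      Matrix.cons_val] at h0 h1 h2
    refine ⟨(hform i j).2 ?_, ?_⟩
    · fin_cases d <;> cases b <;> simp at h0 h1 h2 <;> nlinarith [h0, h1, h2]
    · rintro ⟨d', b', h'⟩
      have g0 := congrFun h' 0; have g1 := congrFun h' 1; have g2 := congrFun h' 2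
      simp only [ha₂, Pi.add_apply, unitStep_apply, Matrix.cons_val_zero, Matrix.cons_val_one,
        Matrix.cons_val] at g0 g1 g2
      fin_cases d <;> cases b <;> fin_cases d' <;> cases b' <;> simp at h0 h1 h2 g0 g1 g2 <;>
        omega
  have hback₂ : ∀ i j (d : Fin 3) (b : Bool), a₂ j = a₂ i + unitStep d b →
      dist (x i) (x j) = 1 := by
    intro i j d b h
    have h0 := congrFun h 0; have h1 := congrFun h 1; have h2 := congrFun h 2
    simp only [ha₂, Pi.add_apply, unitStep_apply, Matrix.cons_val_zero, Matrix.cons_val_one,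
      Matrix.cons_val] at h0 h1 h2
    refine (hform i j).2 ?_
    fin_cases d <;> cases b <;> simp at h0 h1 h2 <;> nlinarith [h0, h1, h2]
  -- the degree of a ball is the number of its chart-1 steps plus its chart-2 steps
  have hdeg : ∀ i, coordination x i =
      (univ.filter fun j => ∃ d : Fin 3, ∃ b : Bool, a₁ j = a₁ i + unitStep d b).card +
        (univ.filter fun j => ∃ d : Fin 3, ∃ b : Bool, a₂ j = a₂ i + unitStep d b).card := by
    intro i
    rw [coordination, ← card_union_of_disjoint]
    · congr 1
      ext j
      rw [mem_contactNeighbors, mem_union, mem_filter, mem_filter]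
      constructor
      · rintro ⟨-, hd⟩
        rcases hstep i j hd with h | h
        · exact Or.inl ⟨mem_univ _, h⟩
        · exact Or.inr ⟨mem_univ _, h⟩
      · rintro (⟨-, d, b, h⟩ | ⟨-, d, b, h⟩)
        · have hd := (hback₁ i j d b h).1
          refine ⟨?_, hd⟩
          rintro rfl; rw [dist_self] at hd; exact absurd hd (by norm_num)
        · have hd := hback₂ i j d b h
          refine ⟨?_, hd⟩
          rintro rfl; rw [dist_self] at hd; exact absurd hd (by norm_num)
    · rw [disjoint_filter]
      intro j _ ⟨d, b, h⟩
      exact (hback₁ i j d b h).2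
  -- sum over balls and apply the slot count in each chart
  have h1 := sum_card_stepNeighbors_add_card_boundaryPairs a₁ ha₁inj
  have h2 := sum_card_stepNeighbors_add_card_boundaryPairs a₂ ha₂inj
  have hhand := sum_coordination_eq x
  have hsum : ∑ i, coordination x i =
      ∑ i, (univ.filter fun j => ∃ d : Fin 3, ∃ b : Bool, a₁ j = a₁ i + unitStep d b).card +
        ∑ i, (univ.filter fun j => ∃ d : Fin 3, ∃ b : Bool, a₂ j = a₂ i + unitStep d b).card := by
    rw [← sum_add_distrib]; exact sum_congr rfl fun i _ => hdeg i
  omega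

/-- **Corollary: the deficiency is half the boundary pairs.** In the situation of
`two_mul_numContacts_add_card_boundaryPairs_eq`,
`6N − numContacts x = (#∂(ψ₁-image) + #∂(ψ₂-image)) / 2` (as reals). -/
theorem fcc_deficiency_eq_half_boundaryPairs {N : ℕ}
    (x : Fin N → EuclideanSpace ℝ (Fin 3)) (hx : IsUnitPacking x) (kf pf qf : Fin N → ℤ)
    (hc : ∀ i, x i = barlowPos 1 (Real.sqrt (2 / 3)) constHagg (kf i) (pf i) (qf i)) :
    6 * (N : ℝ) - (numContacts x : ℝ) =
      (((boundaryPairs (univ.image fun i => (![pf i, qf i + kf i, -kf i] : Site 3))).card : ℝ) +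
        ((boundaryPairs (univ.image fun i =>
          (![kf i + pf i + qf i, pf i + qf i, -qf i] : Site 3))).card : ℝ)) / 2 := by
  have h := two_mul_numContacts_add_card_boundaryPairs_eq x hx kf pf qf hc
  have h' : (2 * numContacts x +
      (boundaryPairs (univ.image fun i => (![pf i, qf i + kf i, -kf i] : Site 3))).card +
      (boundaryPairs (univ.image fun i =>
        (![kf i + pf i + qf i, pf i + qf i, -qf i] : Site 3))).card : ℝ) = 12 * N := by
    exact_mod_cast h
  linarith

end Summit.Ventures.Crystal3D

end
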